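import Summits.ABC.IUTFork.LanaLogKummer
import Summits.ABC.IUTFork.LanaLogShellHF
import HarnessLib

/-!
# L-LANA objects IX bis, REAL instance: the log-Kummer column of `K_v` with the genuine `log_p` — upper semi-compatible, NOT commutative

Record-only sequel (D-0012; seat abc-iut-c312-4 gen 6, L-LANA level, plan/LLANA-SPEC N16 "log-Kummer correspondence
(Fig. 5; 'far from commutative', p. 38); upper semi-compatibility / Ind3 (§7.2 (c))") of `LanaLogKummer.lean`
(gen 0: `LogKummerColumn`, the predicates `Commutes` — "what FAILS" — and `UpperSemiCompatible`, typed over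
ABSTRACT carriers) and `LanaLogShellHF.lean` (gen 2: the REAL holomorphic Frobenius-like log-shell
`(HF) I_v = (2p_v)⁻¹·log_p(O^×_{K_v})` over campaign S's logarithm `unitLog`).  TAKES NO SIDE on [IUTchIII] Cor. 3.12.
THIS file instantiates the column by the GENUINE local objects and decides both predicates there:

* `realColumn p K` — LANA Fig. 5 at a finite place, one column of the big-H: every Frobenius-like carrier
  `ⁿC := K_v`, every `(HF)` log-shell `ⁿI := I_v = (2p)⁻¹·log_p(O^×_{K_v})` (gen 2 `logShellHF`), every log-link
  `ⁿC → ⁿ⁺¹C := log_p` (S1 `unitLog`: Iwasawa/Neukirch `log_p` on `O^×_{K_v}`, junk `0` off `O^×`), the étale-like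
  carrier `E := K_v` with `étI := I_v`, and Kummer maps `ⁿKmm := id` (in the model all carriers are THE SAME copy of
  `K_v`; the Kummer isomorphism is represented by the identity — modelling note below);
* `unitLog_mem_logShellHF` — `log_p(x) ∈ I_v` for EVERY `x ∈ K_v` (`log_p(O^×) ⊆ (2p)⁻¹·log_p(O^×)` since
  `log_p u = (2p)⁻¹·log_p(u^{2p})`; junk `0 = (2p)⁻¹ log_p 1`);
* **`realColumn_upperSemiCompatible`** — LANA §7.2 (c) "the log-shell acts as an upper bound that simultaneously
  contains their images … even after undergoing a shift by the log-link, all required images remain within the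
  log-shell" HOLDS at the real column: `ⁿ⁺ᵏKmm(log_pᵏ(ⁿI)) ⊆ étI` for all `n ∈ ℤ`, `k ∈ ℕ` (`k = 0`: `I ⊆ I`;
  `k ≥ 1`: every `log_p`-value lies in `I`), hence `⋃ images ⊆ étI` (gen 0 `iUnion_images_subset`);
* **`realColumn_not_commutes`** — LANA §7.2 (b) p. 38 "This diagram is far from commutative" is a KERNEL FACT at the
  real column: `¹Kmm ∘ log ≠ ⁰Kmm` since `log_p 1 = 0 ≠ 1`;
* `realColumn_padic_*` — the `ℚ_p` instance (non-vacuity of the hypotheses on `K_v`).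

So FACT-LIST rows F-2217 `UpperSemiCompatible` / F-1909 `Commutes` (both "Summits tree: provable or GAP-able, never
assumable") are, respectively, WITNESSED and REFUTED at the genuine objects.  Modelling notes (honest scope).
(i) `Kmm := id` fixes ONE representative of the Kummer full poly-isomorphism — at the level of a single column this is
the "identified copies" picture; the non-commutativity proved is the intrinsic one (`log_p ≠ id`), which survives
every choice of representative that is a ring isomorphism (it would have to fix `1`).  (ii) `log_p` is extended by
`0` off `O^×_{K_v}` (S1's convention); print applies the log-link to units only — the images of the unit part
`I_v ∩ O^×` are covered a fortiori.  (iii) (Ind3)'s content proper ([IUTchIII] Prop. 3.5 (ii): the `G_v`-equivariant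
étale transport and WHICH composites are "required") is c312-1's `Thm311LogKummer`, not this column.
Setting: `K_v` a nontrivially normed field, normed `ℚ_p`-algebra, ultrametric, complete, proper (every finite
extension of `ℚ_p`). [cite: LANA2026Report, §7.2 (b) p. 38, §7.2 (c) p. 40, §5.1 p. 26] NOT here: any judgement.
-/

noncomputable section

open Set
open scoped Pointwise
open Literature.IUT.LogVolume

namespace Summit.ABC
namespace IUTFork

variable (p : ℕ) [hp : Fact p.Prime]
variable (K : Type) [NontriviallyNormedField K] [NormedAlgebra ℚ_[p] K] [IsUltrametricDist K] [CompleteSpace K]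
  [ProperSpace K]

/-! ## 1. Every `log_p`-value lies in the `(HF)` log-shell -/

omit [CompleteSpace K] in
/-- `log_p(O^×_{K_v}) ⊆ I_v = (2p)⁻¹·log_p(O^×_{K_v})`: `y = (2p)⁻¹·(2p·y)` and `log_p(O^×)` is an additive subgroup
(S1 `logUnitsAddSubgroup`). [cite: LANA2026Report, §5.1 p. 26] -/
theorem logUnits_subset_logShellHF : logUnits K ⊆ logShellHF p K := by
  intro y hy
  haveI := Literature.NumberTheory.Transcendental.IwasawaLog.charZero p (F := K)
  have h2p : ((2 * p : ℕ) : K) ≠ 0 := by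
    have : (2 * p : ℕ) ≠ 0 := Nat.mul_ne_zero two_ne_zero hp.out.ne_zero
    exact_mod_cast this
  have hmem : ((2 * p : ℕ) : K) * y ∈ logUnits K := by
    have h := (logUnitsAddSubgroup p K).nsmul_mem (show y ∈ logUnitsAddSubgroup p K from hy) (2 * p)
    rw [nsmul_eq_mul] at h
    exact h
  refine Set.mem_smul_set.mpr ⟨((2 * p : ℕ) : K) * y, hmem, ?_⟩
  rw [smul_eq_mul, inv_mul_cancel_left₀ h2p]

/-- **`log_p(x) ∈ I_v` for every `x ∈ K_v`**: for a unit it is a member of `log_p(O^×) ⊆ I_v`; off `O^×` the (junk)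
value is `0 = log_p 1 ∈ I_v`. [cite: LANA2026Report, §5.1 p. 26] -/
theorem unitLog_mem_logShellHF (x : K) : unitLog x ∈ logShellHF p K := by
  by_cases hx : ‖x‖ = 1
  · exact logUnits_subset_logShellHF p K (unitLog_mem_logUnits hx)
  · rw [unitLog_of_norm_ne_one hx]
    exact logUnits_subset_logShellHF p K (zero_mem_logUnits (p := p))

/-! ## 2. The real column -/

/-- **LANA Fig. 5 at a finite place with the GENUINE objects**: carriers `ⁿC := K_v` (`n ∈ ℤ`), `(HF)` log-shells
`ⁿI := I_v = (2p)⁻¹·log_p(O^×_{K_v})`, log-links `log_p`, étale-like carrier `K_v` with `étI := I_v`, Kummer maps the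
identity of the common copy `K_v`. [cite: LANA2026Report, §7.2 (b) p. 38] -/
def realColumn : LogKummerColumn where
  C _ := K
  I _ := logShellHF p K
  log _ := unitLog
  E := K
  etI := logShellHF p K
  Kmm _ := id

/-- The `k`-fold log-shift of the real column lands in `I_v` as soon as `k ≥ 1` (its last step is a `log_p`), and
for `k = 0` it is the identity. [cite: LANA2026Report, §7.2 (c) p. 40] -/
theorem realColumn_shift_mem (n : ℤ) (k : ℕ) (x : K) (hx : k = 0 → x ∈ logShellHF p K) :
    (realColumn p K).shift n k x ∈ logShellHF p K := by
  cases k with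
  | zero => exact hx rfl
  | succ k => exact unitLog_mem_logShellHF p K _

/-- **UPPER SEMI-COMPATIBILITY HOLDS at the real column** (LANA §7.2 (c); gen 0's `UpperSemiCompatible` =
L6's `UpperSemiCommutative` for [IUTchIII] Rem. 1.2.2 (iii)): every image `ⁿ⁺ᵏKmm(log_pᵏ(ⁿI))` lies in `étI = I_v`.
[cite: LANA2026Report, §7.2 (c) p. 40] -/
theorem realColumn_upperSemiCompatible : (realColumn p K).UpperSemiCompatible := by
  rintro ⟨n, k⟩ _ ⟨y, ⟨x, hx, rfl⟩, rfl⟩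
  exact realColumn_shift_mem p K n k x (fun _ => hx)

/-- Hence the union of ALL images (all starting levels, all numbers of shifts) lies in the étale log-shell `I_v`
(gen 0 `iUnion_images_subset`, instantiated). [cite: LANA2026Report, §7.2 (c) p. 40] -/
theorem realColumn_iUnion_images_subset : (⋃ i, (realColumn p K).imageAfterShifts i) ⊆ logShellHF p K :=
  (realColumn p K).iUnion_images_subset (realColumn_upperSemiCompatible p K)

omit [ProperSpace K] in
/-- **"THIS DIAGRAM IS FAR FROM COMMUTATIVE" (LANA §7.2 (b) p. 38) at the real column**: `¹Kmm ∘ log_p ≠ ⁰Kmm`,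
witnessed at `x = 1` (`log_p 1 = 0 ≠ 1`). [cite: LANA2026Report, §7.2 (b) p. 38] -/
theorem realColumn_not_commutes : ¬ (realColumn p K).Commutes := by
  intro h
  have h1 : unitLog (1 : K) = 1 := h 0 (1 : K)
  rw [unitLog_one p] at h1
  exact zero_ne_one h1

omit hp [NormedAlgebra ℚ_[p] K] [IsUltrametricDist K] [CompleteSpace K] [ProperSpace K] in
/-- What fails, pointwise: the log-link moves every `x ∉ {log_p x = x}`, in particular every unit `u` with
`log_p u ≠ u` and every non-unit `x ≠ 0`. [cite: LANA2026Report, §7.2 (b) p. 38] -/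
theorem realColumn_kmm_log_ne {x : K} (hx : unitLog x ≠ x) (n : ℤ) :
    (realColumn p K).Kmm (n + 1) ((realColumn p K).log n x) ≠ (realColumn p K).Kmm n x := hx

/-! ## 3. The `ℚ_p` instance (non-vacuity of the hypotheses on `K_v`) -/

/-- At `K_v = ℚ_p` the real column is upper semi-compatible … [cite: LANA2026Report, §7.2 (c) p. 40] -/
theorem realColumn_padic_upperSemiCompatible : (realColumn p ℚ_[p]).UpperSemiCompatible :=
  realColumn_upperSemiCompatible p ℚ_[p]

/-- … and not commutative. [cite: LANA2026Report, §7.2 (b) p. 38] -/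
theorem realColumn_padic_not_commutes : ¬ (realColumn p ℚ_[p]).Commutes :=
  realColumn_not_commutes p ℚ_[p]

/-- So gen 0's two predicates are each DECIDED at a genuine column: `UpperSemiCompatible` is satisfiable (here) —
and refutable on other columns (e.g. shrink `étI` to `∅`) — while `Commutes` fails here; in particular
`UpperSemiCompatible` does not imply `Commutes`. [cite: LANA2026Report, §7.2 (b),(c) pp. 38–40] -/
theorem upperSemiCompatible_not_imp_commutes (p : ℕ) [Fact p.Prime] :
    ¬ ∀ L : LogKummerColumn, L.UpperSemiCompatible → L.Commutes := fun h =>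
  realColumn_padic_not_commutes p (h _ (realColumn_padic_upperSemiCompatible p))

end IUTFork

end Summit.ABC

end
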